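import Literature.NumberTheory.PAdicHodge.AinfWeierstrassRamifiedCoeffBridge
import Literature.NumberTheory.PAdicHodge.EisensteinRootShortModel
import HarnessLib

/-!
# The K★ cell models in the `𝒪_F`-currency: unit discriminant, supersingular reduction of exact height `2`, and the
# Tate-module witness `‖p‖ < ‖τ₁‖^p` — UNCONDITIONALLY (proofs only)

Topic `Literature/NumberTheory/PAdicHodge`; namespace `Literature.NumberTheory.PAdicHodge`. THEOREMS ONLY (no definition, no named
fact, no instance, no `sorry`). Assembly of `AinfWeierstrassRamifiedCoeffBridge` (the point witness / η-transversality for `W_D ⊗_β 𝒪_F`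
GRANTED `IsUnit Δ`, `A_p = 0`, exact height) and `EisensteinRootShortModel` (these three facts for the explicit models
`W_D = ⟨0,0,0,a ϱ^{r₄}, b ϱ^{r₆}⟩` over `𝒪_D = ℤ_p[X]/(X^e − p)`, along ANY `γ : 𝒪_D → k` into a field of characteristic `p`).

For `β : 𝒪_D →+* LTCoeff F` (e.g. the bridge of `EisensteinRoot.exists_coeffToLTCoeff`) and the model `W := W_D ⊗_β 𝒪_F`:
* `isUnit_Δ_map_model`, `hasseCoeff_red_map_model_eq_zero`, `coeff_sq_formalMul_red_map_model_ne_zero` — the three reduction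
  hypotheses of the bridge theorems, DISCHARGED (`γ := redCoeff F ∘ β`; residue characteristic `p` from `[CharP 𝓀[F] p]`);
* **`exists_tatePtO_norm_p_lt_norm_pow_model`** — `∃ τ ∈ T_pŴ(𝒪_{ℂ_F})`, `τ₁ ≠ 0`, `‖p‖ < ‖τ₁‖^p` (the η-side witness (Nη) AND an
  ω-side witness `τ₁ ≠ 0` for (N1′), cf. `AinfRamifiedOmegaPeriodNonvanishingVarpi`);
* **`mulDefect_evalPt₁_not_mem_span_p_model`** — `R_p(u) ∉ p𝒪_{ℂ_F}` at every `u` with `‖p‖ < ‖u‖^p` (η-transversality).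
Hypotheses: `p ∈ {5, 7}` with `r₄ > 0` at `5`, `r₆ > 0` at `7`, `3r₄ = e t₄`, `2r₆ = e t₆`, `64a³p^{t₄} + 432b²p^{t₆} ∈ ℤ_pˣ`.

BSD route EdixhovenFibreFiveSeven, crux K★ `stmt-BirchSwinnertonDyer-22226`, road (R1): with this file every COEFFICIENT-SIDE input
of the de Rham socket for the three potentially supersingular cells is a theorem; the RING side (periods over `A_inf(𝒪)`) remains.
BSD is not proved by any of this.

## References
* [Serre1972] J.-P. Serre, Invent. Math. 15 (1972), §1.11.
* [SilvermanAEC2009] J. H. Silverman, *AEC* (2009), IV.7.5, VII.2.2.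
-/

noncomputable section

open scoped Classical
open Field ValuativeRel Polynomial

namespace Literature.NumberTheory.PAdicHodge

open Literature.NumberTheory.GaloisRepresentations
open Literature.NumberTheory.GaloisRepresentations.IsNonarchimedeanLocalField
open Literature.NumberTheory.GaloisRepresentations.LubinTate
open Literature.NumberTheory.EllipticCurves

namespace AinfTop

variable {F : Type} [Field F] [ValuativeRel F] [TopologicalSpace F] [IsNonarchimedeanLocalField F] [CharZero F]
  {p : ℕ} [Fact p.Prime] {hp : valuation F p < 1} {D : EisensteinRoot F p hp} [CharP 𝓀[F] p] {e : ℕ}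
  (hD : D.poly = X ^ e - C (p : ℤ_[p])) (β : D.Coeff →+* LTCoeff F) (a b : ℤ_[p]) {r₄ r₆ t₄ t₆ : ℕ}

include hD

omit [CharP 𝓀[F] p] in
/-- **Unit discriminant of `W_D ⊗_β 𝒪_F`** for the model (`3r₄ = e t₄`, `2r₆ = e t₆`, `64a³p^{t₄} + 432b²p^{t₆} ∈ ℤ_pˣ`).
[cite: SilvermanAEC2009, VII.5.5] -/
theorem isUnit_Δ_map_model (h₄ : 3 * r₄ = e * t₄) (h₆ : 2 * r₆ = e * t₆)
    (hu : IsUnit (64 * a ^ 3 * (p : ℤ_[p]) ^ t₄ + 432 * b ^ 2 * (p : ℤ_[p]) ^ t₆)) :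
    IsUnit ((⟨0, 0, 0, AdjoinRoot.of D.poly a * AdjoinRoot.root D.poly ^ r₄, AdjoinRoot.of D.poly b * AdjoinRoot.root D.poly ^ r₆⟩ :
      WeierstrassCurve D.Coeff).map β).Δ := by
  rw [WeierstrassCurve.map_Δ]
  exact (isUnit_Δ_model (D.root_pow_eq_of_poly_eq hD) a b h₄ h₆ hu).map β

/-- **Supersingular reduction of `W_D ⊗_β 𝒪_F`** for the model at `p ∈ {5, 7}` (`r₄ > 0` at `5`, `r₆ > 0` at `7`), read along
`redCoeff F ∘ β : 𝒪_D → 𝓀_F`. [cite: SilvermanAEC2009, V.4.1] -/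
theorem hasseCoeff_red_map_model_eq_zero (hp57 : p = 5 ∨ p = 7) (hr₄ : p = 5 → 0 < r₄) (hr₆ : p = 7 → 0 < r₆) :
    (((⟨0, 0, 0, AdjoinRoot.of D.poly a * AdjoinRoot.root D.poly ^ r₄, AdjoinRoot.of D.poly b * AdjoinRoot.root D.poly ^ r₆⟩ :
      WeierstrassCurve D.Coeff).map β).map (redCoeff F)).hasseCoeff p = 0 := by
  rw [WeierstrassCurve.map_map]
  have hroot := D.root_pow_eq_of_poly_eq hD
  rcases hp57 with rfl | rfl
  · exact hasseCoeff_map_model_five_eq_zero hroot a b (hr₄ rfl) r₆ _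
  · exact hasseCoeff_map_model_seven_eq_zero hroot a b r₄ (hr₆ rfl) _

/-- **Exact height `2` of the reduction of `W_D ⊗_β 𝒪_F`** for the model (any residue field of characteristic `p`).
[cite: SilvermanAEC2009, IV.7.5] -/
theorem coeff_sq_formalMul_red_map_model_ne_zero (hp57 : p = 5 ∨ p = 7) (h₄ : 3 * r₄ = e * t₄) (h₆ : 2 * r₆ = e * t₆)
    (hu : IsUnit (64 * a ^ 3 * (p : ℤ_[p]) ^ t₄ + 432 * b ^ 2 * (p : ℤ_[p]) ^ t₆)) (hr₄ : p = 5 → 0 < r₄) (hr₆ : p = 7 → 0 < r₆) :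
    PowerSeries.coeff (p ^ 2) ((((⟨0, 0, 0, AdjoinRoot.of D.poly a * AdjoinRoot.root D.poly ^ r₄,
      AdjoinRoot.of D.poly b * AdjoinRoot.root D.poly ^ r₆⟩ : WeierstrassCurve D.Coeff).map β).map (redCoeff F)).formalMul p) ≠ 0 := by
  have hp5 : 5 ≤ p := by rcases hp57 with rfl | rfl <;> norm_num
  have hA := hasseCoeff_red_map_model_eq_zero hD β a b (r₄ := r₄) (r₆ := r₆) hp57 hr₄ hr₆
  rw [WeierstrassCurve.map_map] at hA ⊢
  exact coeff_sq_formalMul_map_model_ne_zero hp5 (D.root_pow_eq_of_poly_eq hD) a b r₄ r₆ _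
    (Δ_map_ne_zero_of_isUnit _ (isUnit_Δ_model (D.root_pow_eq_of_poly_eq hD) a b h₄ h₆ hu) _) hA

/-- **The Tate-module witness for the cell models, unconditionally**: some `τ ∈ T_pŴ(𝒪_{ℂ_F})` (of `W_D ⊗_β 𝒪_F`) has `τ₁ ≠ 0` and
`‖p‖ < ‖τ₁‖^p` (a `p`-torsion point outside the canonical subgroup, lifted to the Tate module). [cite: Serre1972, §1.11]
[cite: SilvermanAEC2009, Prop. VII.2.2] -/
theorem exists_tatePtO_norm_p_lt_norm_pow_model (hp57 : p = 5 ∨ p = 7) (h₄ : 3 * r₄ = e * t₄) (h₆ : 2 * r₆ = e * t₆)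
    (hu : IsUnit (64 * a ^ 3 * (p : ℤ_[p]) ^ t₄ + 432 * b ^ 2 * (p : ℤ_[p]) ^ t₆)) (hr₄ : p = 5 → 0 < r₄) (hr₆ : p = 7 → 0 < r₆) :
    ∃ τ : TatePtO F ((⟨0, 0, 0, AdjoinRoot.of D.poly a * AdjoinRoot.root D.poly ^ r₄,
        AdjoinRoot.of D.poly b * AdjoinRoot.root D.poly ^ r₆⟩ : WeierstrassCurve D.Coeff).map β) p,
      ((((TateModule.proj p 1 τ).val : (maxNilIdealC F).toIdeal) : CBall F) : CompletedAlgClosure F) ≠ 0 ∧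
      ‖(p : CompletedAlgClosure F)‖ <
        ‖((((TateModule.proj p 1 τ).val : (maxNilIdealC F).toIdeal) : CBall F) : CompletedAlgClosure F)‖ ^ p := by
  have hp2 : p ≠ 2 := by rcases hp57 with rfl | rfl <;> norm_num
  exact exists_tatePtO_norm_p_lt_norm_pow_of_map D β _ hp2 (isUnit_Δ_map_model hD β a b h₄ h₆ hu)
    (hasseCoeff_red_map_model_eq_zero hD β a b hp57 hr₄ hr₆)
    (coeff_sq_formalMul_red_map_model_ne_zero hD β a b hp57 h₄ h₆ hu hr₄ hr₆)

/-- **η-transversality for the cell models, unconditionally**: for any integral lift `Rn ∈ 𝒪_F⟦X⟧` of the quasi-period defect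
`R_p` of `W_D ⊗ F` and every `u ∈ 𝔪_{ℂ_F}` with `‖p‖ < ‖u‖^p`: `R_p(u) ∉ p𝒪_{ℂ_F}`. [cite: Serre1972, §1.11] -/
theorem mulDefect_evalPt₁_not_mem_span_p_model (hp57 : p = 5 ∨ p = 7) (h₄ : 3 * r₄ = e * t₄) (h₆ : 2 * r₆ = e * t₆)
    (hu : IsUnit (64 * a ^ 3 * (p : ℤ_[p]) ^ t₄ + 432 * b ^ 2 * (p : ℤ_[p]) ^ t₆)) (hr₄ : p = 5 → 0 < r₄) (hr₆ : p = 7 → 0 < r₆)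
    {Rn : PowerSeries (LTCoeff F)}
    (hRn : PowerSeries.map (algebraMap (LTCoeff F) F) Rn =
      (((⟨0, 0, 0, AdjoinRoot.of D.poly a * AdjoinRoot.root D.poly ^ r₄, AdjoinRoot.of D.poly b * AdjoinRoot.root D.poly ^ r₆⟩ :
        WeierstrassCurve D.Coeff).map β).map (algebraMap (LTCoeff F) F)).formalQuasiPeriodMulDefect p)
    (hRn0 : PowerSeries.constantCoeff Rn = 0) (u : (maxNilIdealC F).toIdeal)
    (hpu : ‖(p : CompletedAlgClosure F)‖ < ‖((u : CBall F) : CompletedAlgClosure F)‖ ^ p) :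
    (evalPt₁ (maxNilIdealC F) Rn hRn0 u : CBall F) ∉ Ideal.span {(p : CBall F)} := by
  have hp2 : p ≠ 2 := by rcases hp57 with rfl | rfl <;> norm_num
  exact mulDefect_evalPt₁_not_mem_span_p_of_map D β _ hp2 (isUnit_Δ_map_model hD β a b h₄ h₆ hu)
    (hasseCoeff_red_map_model_eq_zero hD β a b hp57 hr₄ hr₆) hRn hRn0 u hpu

end AinfTop

end Literature.NumberTheory.PAdicHodge

end
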